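import Literature.Algebra.Homology.DiscreteRepLayerColimitGroupCohomology
import Literature.Algebra.Homology.DiscreteRepStandardResolution
import HarnessLib

/-!
# Divisibility and torsion of `Hⁿ_cont(Γ, M)` read on the finite layers `Hⁿ(Γ⧸U, M^U)`
# (Serre I §2.2 Prop. 8: `Hⁿ(Γ, M) = lim→ Hⁿ(Γ⧸U, M^U)`, applied to `m·` and to `m`-torsion)

Topic `Algebra/Homology`; namespace `Literature.Algebra.Homology.DiscreteRep.LayerColimit`.  THEOREMS
ONLY (no definition, no named fact, no `sorry`, no instance; D-0026).  Sequel of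
`DiscreteRepLayerColimitGroupCohomology` (`Extⁿ_{C_Γ}(k, M) = lim→_U Hⁿ(Γ⧸U, M^U)` over the open
normal subgroups of a profinite `Γ`, layers in Mathlib's `groupCohomology`, transitions `stepG`,
inflations `inflG`; surjectivity `exists_inflG_eq`, injectivity `exists_stepG_eq_zero`) and of
`DiscreteRepStandardResolution` (`Φ : Extⁿ_{C_Γ}(k, X) ≃+ Hⁿ_cont(Γ, X)`).

Serre, *Cohomologie galoisienne* I §2.2 Prop. 8 ("`H^q(G, A) = lim→ H^q(G/U, A^U)`") has the two
standard elementwise consequences used in Neukirch–Schmidt–Wingberg's proof of (8.3.18) (the limit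
group `Hʳ(G_S, E_S) = lim→ Hʳ(G_S(K)/G_S(L), 𝒪_{L,S}^×)` is read on the finite layers):

* **multiplication by `m` is ONTO the limit group** as soon as every finite-layer class becomes, in
  some deeper layer, `m` times a class (`ext_nsmul_surjective_of_layers`,
  `continuousCohomology_nsmul_surjective_of_layers`);
* **the limit group has no `m`-torsion** as soon as every finite-layer class killed by `m` dies in
  some deeper layer (`ext_eq_zero_of_nsmul_eq_zero_of_layers`,
  `continuousCohomology_eq_zero_of_nsmul_eq_zero_of_layers`).

Written for lane «PT3-TC» of cell `bsd-eis` (crux `GoodLatticeBDPValue`, stmt-BirchSwinnertonDyer-19032;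
road memo `PT3TC-ROAD.md`, brick (A2-α)): with `Γ = U ≤ G_{K,S}` open, `M = E_S` the `S`-units of
`K_S` and `m = p`, these turn the finite-layer statements (iii-fin)/(iv-fin) of NSW (8.3.11) into
"`H²(U, E_S)` is `p`-divisible" and "`H³(U, E_S)[p] = 0`".

## References
* J.-P. Serre, *Cohomologie galoisienne* (1994), I §2.2 Prop. 8. [SerreGaloisCohomology1997]
* J. Neukirch, A. Schmidt, K. Wingberg, *Cohomology of Number Fields*, 2nd ed. (2008), (1.5.1),
  proof of (8.3.18) via (8.3.11). [NeukirchSchmidtWingberg2008]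
* D. Harari, *Galois Cohomology and Class Field Theory* (2020), Prop. 4.18, Remark 4.24. [Harari2020]
-/

noncomputable section

namespace Literature.Algebra.Homology

namespace DiscreteRep

namespace LayerColimit

open CategoryTheory CategoryTheory.Limits CategoryTheory.Abelian

universe u

variable {k Γ : Type u} [CommRing k] [Group Γ] [TopologicalSpace Γ] [IsTopologicalGroup Γ]
  [CompactSpace Γ] [TotallyDisconnectedSpace Γ]

/-! ### §1 On `Extⁿ_{C_Γ}(k, M)` -/

/-- **`m·` is onto `Extⁿ_{C_Γ}(k, M)` when every layer class becomes `m`-divisible deeper**: if for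
every open normal `U` and every `c ∈ Hⁿ(Γ⧸U, M^U)` there are `V ≤ U` and `z ∈ Hⁿ(Γ⧸V, M^V)` with
`m • z = stepG U V c`, then every class of `Extⁿ_{C_Γ}(k, M)` is `m` times a class.
[cite: SerreGaloisCohomology1997, I §2.2 Prop. 8] [cite: NeukirchSchmidtWingberg2008, (1.5.1)] -/
theorem ext_nsmul_surjective_of_layers (n : ℕ) (M : DiscreteRepCat k Γ) (m : ℕ)
    (h : ∀ (U : OpenNormalSubgroup Γ)
      (c : groupCohomology ((invariantsQuotFunctor k (U : Subgroup Γ)).obj M) n),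
      ∃ (V : OpenNormalSubgroup Γ) (hVU : (V : Subgroup Γ) ≤ U)
        (z : groupCohomology ((invariantsQuotFunctor k (V : Subgroup Γ)).obj M) n),
        m • z = stepG U V hVU M n c)
    (x : Ext (triv (Γ := Γ) k) M n) : ∃ y : Ext (triv (Γ := Γ) k) M n, m • y = x := by
  obtain ⟨U, c, rfl⟩ := exists_inflG_eq n M x
  obtain ⟨V, hVU, z, hz⟩ := h U c
  refine ⟨inflG V M n z, ?_⟩
  rw [← map_nsmul, hz, inflG_stepG]

/-- **`Extⁿ_{C_Γ}(k, M)` has no `m`-torsion when every `m`-torsion layer class dies deeper**: if for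
every open normal `U` and every `c ∈ Hⁿ(Γ⧸U, M^U)` with `m • c = 0` there is `V ≤ U` with
`stepG U V c = 0`, then `m • x = 0 ⟹ x = 0` in `Extⁿ_{C_Γ}(k, M)` (a class with `m • x = 0` comes from
a layer class `c` with `m • c` dying in some deeper layer — injectivity of the colimit — where the
hypothesis applies). [cite: SerreGaloisCohomology1997, I §2.2 Prop. 8] [cite: NeukirchSchmidtWingberg2008, (1.5.1)] -/
theorem ext_eq_zero_of_nsmul_eq_zero_of_layers (n : ℕ) (M : DiscreteRepCat k Γ) (m : ℕ)
    (h : ∀ (U : OpenNormalSubgroup Γ)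
      (c : groupCohomology ((invariantsQuotFunctor k (U : Subgroup Γ)).obj M) n),
      m • c = 0 → ∃ (V : OpenNormalSubgroup Γ) (hVU : (V : Subgroup Γ) ≤ U), stepG U V hVU M n c = 0)
    (x : Ext (triv (Γ := Γ) k) M n) (hx : m • x = 0) : x = 0 := by
  obtain ⟨U, c, rfl⟩ := exists_inflG_eq n M x
  rw [← map_nsmul] at hx
  obtain ⟨V, hVU, hV⟩ := exists_stepG_eq_zero n M U (m • c) hx
  rw [map_nsmul] at hV
  obtain ⟨W, hWV, hW⟩ := h V (stepG U V hVU M n c) hV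
  rw [stepG_stepG] at hW
  rw [← inflG_stepG U W (hWV.trans hVU) M n c, hW, map_zero]

/-! ### §2 On `Hⁿ_cont(Γ, X)` (Mathlib's continuous cohomology), through `Φ` -/

variable [TopologicalSpace k]

open TopRep in
/-- **`m·` is onto `Hⁿ_cont(Γ, X)`** for a topologically discrete `X` with open stabilisers, when
every finite-layer class `c ∈ Hⁿ(Γ⧸U, X^U)` becomes `m` times a class in some deeper layer
(transport of `ext_nsmul_surjective_of_layers` along `Φ : Extⁿ_{C_Γ}(k, X) ≃+ Hⁿ_cont(Γ, X)`).
[cite: SerreGaloisCohomology1997, I §2.2 Prop. 8] [cite: Harari2020, Prop. 4.18, Remark 4.24] -/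
theorem continuousCohomology_nsmul_surjective_of_layers (X : TopRep.{u} k Γ) [DiscreteTopology X.V]
    (hX : IsDiscrete ((forgetTop k Γ).obj X)) (n m : ℕ)
    (h : ∀ (U : OpenNormalSubgroup Γ)
      (c : groupCohomology ((invariantsQuotFunctor k (U : Subgroup Γ)).obj (stdBase X hX)) n),
      ∃ (V : OpenNormalSubgroup Γ) (hVU : (V : Subgroup Γ) ≤ U)
        (z : groupCohomology ((invariantsQuotFunctor k (V : Subgroup Γ)).obj (stdBase X hX)) n),
        m • z = stepG U V hVU (stdBase X hX) n c)
    (y : (continuousCohomology n X : TopModuleCat.{u} k)) :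
    ∃ z : (continuousCohomology n X : TopModuleCat.{u} k), m • z = y := by
  let Φ := extTrivAddEquivContinuousCohomology X hX n
  obtain ⟨x, hx⟩ := ext_nsmul_surjective_of_layers n (stdBase X hX) m h (Φ.symm y)
  refine ⟨Φ x, ?_⟩
  rw [← map_nsmul, hx, AddEquiv.apply_symm_apply]

open TopRep in
/-- **`Hⁿ_cont(Γ, X)` has no `m`-torsion** for a topologically discrete `X` with open stabilisers,
when every finite-layer class killed by `m` dies in some deeper layer (transport of
`ext_eq_zero_of_nsmul_eq_zero_of_layers` along `Φ`).
[cite: SerreGaloisCohomology1997, I §2.2 Prop. 8] [cite: Harari2020, Prop. 4.18, Remark 4.24] -/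
theorem continuousCohomology_eq_zero_of_nsmul_eq_zero_of_layers (X : TopRep.{u} k Γ)
    [DiscreteTopology X.V] (hX : IsDiscrete ((forgetTop k Γ).obj X)) (n m : ℕ)
    (h : ∀ (U : OpenNormalSubgroup Γ)
      (c : groupCohomology ((invariantsQuotFunctor k (U : Subgroup Γ)).obj (stdBase X hX)) n),
      m • c = 0 → ∃ (V : OpenNormalSubgroup Γ) (hVU : (V : Subgroup Γ) ≤ U),
        stepG U V hVU (stdBase X hX) n c = 0)
    (y : (continuousCohomology n X : TopModuleCat.{u} k)) (hy : m • y = 0) : y = 0 := by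
  let Φ := extTrivAddEquivContinuousCohomology X hX n
  have h1 : m • Φ.symm y = 0 := by rw [← map_nsmul, hy, map_zero]
  have h2 := ext_eq_zero_of_nsmul_eq_zero_of_layers n (stdBase X hX) m h (Φ.symm y) h1
  rw [← Φ.apply_symm_apply y, h2, map_zero]

end LayerColimit

end DiscreteRep

end Literature.Algebra.Homology

end
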